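import Summits.Ventures.Crystal3D.Theorems.StickyWulffConstantNoReconstructionGainGrainFrameCaps
import HarnessLib

/-!
# The weak points of the first regime of the three-contact cap budget (pure real arithmetic)

HONEST FRAMING. Part of the venture `Summits/Ventures/Crystal3D` (cell `crystal3d-full`), helper
`--supports` the crux `NoReconstructionGain` (stmt-Ventures-19144, route
`route-Ventures-StickyWulffConstant`), line `adhesion` (wulff-p1 g12); a brick of the open stub
`stub_frameCapBudget` (skeleton v15), case of three substrate contacts.

Coordinates as in `…GrainFrameSplA` / `…GrainFrameCaps` (scaled cubic coordinates, pole
`S = (a, b, c)` sorted `0 ≤ a ≤ b ≤ c`, `a² + b² + c² = 2`, down directions `d₁ = (0,1,1)`, `d₂ = (1,0,1)`,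
`d₃ = (1,1,0)`, `d₄ = (−1,0,1)`, `d₅ = (0,−1,1)`, `d₆ = (−1,1,0)` of depths `b+c ≥ a+c ≥ max(a+b, c−a) ≥ …`).

FIRST REGIME of the three-contact budget: `max(a+b, c−a) < 2t ≤ a+c` (so `0 < a` and `b < c`): the two
deepest directions `d₁, d₂` are steep, and a third credit is any strictly-down direction among
`d₃, d₄, d₅, d₆` blocked by a contact.  `weakI_coords` classifies the contacts `u = (x,y,z)` of depth
`> max(a+b, c−a)` that block NONE of those ("weak points"): `u` is the vertex `d₁` or `d₂`, or blocks
both `d₁, d₂` strictly (the edge cell of `d₁d₂`; with `ecell_bound` it lies within `30°` of the edge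
midpoint), or blocks `d₂` and the up/level direction `−d₆ = (1,−1,0)` and not `−d₄` (the edge cell of
`d₂(−d₆)`), or — only on the mirror plane `a = b` — blocks `d₁` and the level `d₆` and not `−d₅` (the
edge cell of `d₁d₆`).  The two exclusions `x − z ≤ 1`, `y − z ≤ 1` are where the depth is used: the
corner cells beyond are too shallow (sharp exactly at the normal `(1,1,3)/√11`).

WHAT THIS IS NOT: the budget itself; rung F-C1 not moved.
-/

namespace Summit.Ventures.Crystal3D.Theorems

section weakI
variable {a b c x y z : ℝ} (ha : 0 < a) (hab : a ≤ b) (hbc : b < c)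
  (hS : a ^ 2 + b ^ 2 + c ^ 2 = 2) (hu : x ^ 2 + y ^ 2 + z ^ 2 = 2)
  (hd3 : a + b < a * x + b * y + c * z) (hd4 : c - a < a * x + b * y + c * z)
include ha hab hbc hS hu hd3 hd4

omit hS in
/-- A weak point that blocks neither `d₁` nor `d₂` does not exist (the remaining cells are too
shallow). -/
theorem weakI_false_of_not_blocks (n3 : x + y ≤ 1) (n4 : z - x ≤ 1) (n5 : z - y ≤ 1)
    (n6 : a < b → y - x ≤ 1) (h1 : y + z ≤ 1) (h2 : x + z ≤ 1) : False := by
  have hc : 0 < c := by linarith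
  -- `z ≤ 0`
  have hz : z ≤ 0 := by
    by_contra hz; push Not at hz
    have hx2 : x ^ 2 ≤ (1 - z) ^ 2 := by nlinarith
    have hy2 : y ^ 2 ≤ (1 - z) ^ 2 := by nlinarith
    have hz1 : z ≤ 1 := by nlinarith
    nlinarith
  have hcz : c * z ≤ 0 := by nlinarith
  rcases lt_or_eq_of_le hab with hab' | hab'
  · have hy1 : y ≤ 1 := by linarith [n6 hab']
    have h1' : a * (x + y) ≤ a := by nlinarith
    have h2' : (b - a) * y ≤ b - a := by nlinarith
    nlinarith
  · subst hab'
    have h1' : a * (x + y) ≤ a := by nlinarith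
    nlinarith

omit hS in
/-- A weak point (indeed any point of depth `> max(a+b, c−a)` not blocking `d₃`) does not block
`−d₄ = (1,0,−1)`: the cells beyond are too shallow (tangent plane `4x − y + z ≤ 6` at the deepest
corner `(4/3,−1/3,1/3)`, sharp exactly at the normal `(1,1,3)/√11`). -/
theorem weakI_not_blocks_negD4 (n3 : x + y ≤ 1) : x - z ≤ 1 := by
  by_contra h; push Not at h
  have htan : 4 * x - y + z ≤ 6 := by
    nlinarith [sq_nonneg (x - 4 / 3), sq_nonneg (y + 1 / 3), sq_nonneg (z - 1 / 3)]
  -- `δ = α(4x−y+z) + β(x+y) − γ(x−z)` with `α = (a−b+c)/6`, `β = b + α`, `γ = c − α`, all `≥ 0`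
  have hα : 0 ≤ (a - b + c) / 6 := by linarith
  have hβ : 0 ≤ b + (a - b + c) / 6 := by linarith
  have hγ : 0 ≤ c - (a - b + c) / 6 := by linarith
  have hδ : a * x + b * y + c * z ≤ (4 * a - b + c) / 3 := by
    have e : a * x + b * y + c * z =
        (a - b + c) / 6 * (4 * x - y + z) + (b + (a - b + c) / 6) * (x + y) - (c - (a - b + c) / 6) * (x - z) := by
      ring
    rw [e]
    nlinarith [mul_le_mul_of_nonneg_left htan hα, mul_le_mul_of_nonneg_left n3 hβ,
      mul_le_mul_of_nonneg_left h.le hγ]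
  rcases le_or_gt (a + c) (4 * b) with h4 | h4
  · -- `(4a − b + c)/3 ≤ a + b`
    linarith
  · -- `(4a − b + c)/3 ≤ c − a`
    linarith

/-- On the mirror plane `a = b`: a weak point blocking `d₁` and `d₆` does not block `−d₅ = (0,1,−1)`. -/
theorem weakI_not_blocks_negD5 (hab' : a = b) (n3 : x + y ≤ 1) (h6 : 1 < y - x) (h1 : 1 < y + z) :
    y - z ≤ 1 := by
  subst hab'
  by_contra h; push Not at h
  have hc : 0 < c := by linarith
  -- `z < 1/3`
  have hz : z < 1 / 3 := by
    rcases lt_or_ge z 0 with hz | hz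
    · linarith
    · have hx : x < -z := by linarith
      have hx2 : z ^ 2 < x ^ 2 := by nlinarith
      have hy2 : (1 + z) ^ 2 < y ^ 2 := by nlinarith
      nlinarith
  have hδ : a * x + a * y + c * z < a + c / 3 := by nlinarith
  rcases le_or_gt c (3 * a) with h3 | h3
  · linarith
  · linarith

/-- **The weak points of the first regime.**  See the module docstring. -/
theorem weakI_coords (n3 : x + y ≤ 1) (n4 : z - x ≤ 1) (n5 : z - y ≤ 1) (n6 : a < b → y - x ≤ 1) :
    (x = 0 ∧ y = 1 ∧ z = 1) ∨ (x = 1 ∧ y = 0 ∧ z = 1) ∨ (1 < y + z ∧ 1 < x + z) ∨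
    (1 < x + z ∧ 1 < x - y ∧ x - z ≤ 1 ∧ y + z ≤ 1) ∨
    (a = b ∧ 1 < y + z ∧ 1 < y - x ∧ y - z ≤ 1 ∧ x + z ≤ 1) := by
  by_cases h1 : 1 < y + z
  · by_cases h2 : 1 < x + z
    · exact Or.inr (Or.inr (Or.inl ⟨h1, h2⟩))
    · push Not at h2
      by_cases h6 : 1 < y - x
      · have hab' : a = b := by
          by_contra hne
          exact absurd (n6 (lt_of_le_of_ne hab hne)) (not_le.2 h6)
        exact Or.inr (Or.inr (Or.inr (Or.inr
          ⟨hab', h1, h6, weakI_not_blocks_negD5 ha hab hbc hS hu hd3 hd4 hab' n3 h6 h1, h2⟩)))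
      · push Not at h6
        exact Or.inl (vertex_of_blocks_only hu h1 h2 n3 n4 h6)
  · push Not at h1
    by_cases h2 : 1 < x + z
    · by_cases hn6 : 1 < x - y
      · exact Or.inr (Or.inr (Or.inr (Or.inl
          ⟨h2, hn6, weakI_not_blocks_negD4 ha hab hbc hu hd3 hd4 n3, h1⟩)))
      · push Not at hn6
        have hu' : y ^ 2 + x ^ 2 + z ^ 2 = 2 := by linarith
        obtain ⟨hy, hx, hz⟩ := vertex_of_blocks_only hu' h2 h1 (by linarith) n5 hn6
        exact Or.inr (Or.inl ⟨hx, hy, hz⟩)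
    · push Not at h2
      exact (weakI_false_of_not_blocks ha hab hbc hu hd3 hd4 n3 n4 n5 n6 h1 h2).elim

end weakI

end Summit.Ventures.Crystal3D.Theorems
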